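import Mathlib.NumberTheory.Padics.PadicVal.Basic
import Literature.Computability.Cryptography.SIS
import Literature.Computability.Complexity.TimeBoundsProofs
import HarnessLib

/-!
# Micciancio–Regev 2007, Lemma 5.5: SIS solutions yield SIS′ solutions for odd moduli (math level)

Topic `Computability/Cryptography` (family `pqc`), namespace
`Literature.Computability.Cryptography.SIS`. First brick of the derivation of the GapSVP → SIS
form for odd moduli of Micciancio–Regev's worst-case/average-case connection (MR07 Thm. 5.23
with Lemmas 5.22 and 5.5; "or SIS when the modulus `q` is odd", authors' full version p. 28 —
not a named fact of the tree: it is the conclusion of the proved theorem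
`Literature.Computability.Cryptography.MicciancioRegev2007_gapSVP_to_SIS_of_SIS'` of
`GapSVPToSISOdd.lean`) from its SIS′ twin, the named fact `MicciancioRegev2007_gapSVP_to_SIS'`
(`SIS.lean`, MR07 Thm. 5.23 with Lemma 5.22): the
missing link is exactly MR07 **Lemma 5.5** — an average-case SIS solver is turned into an
average-case SIS′ solver with at least the same success probability, by the polynomial-time
post-processing "divide the solution by the largest power of two dividing all its coordinates".
This file is the MATHEMATICS of that lemma; the polynomial running time of the post-processing
(an explicit `FP` string function acting on the codes of integer vectors) is the sibling
`SISOddPartMachine.lean`, and the assembly is `GapSVPToSISOdd.lean`.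

* `SIS.vecGcd z` — the gcd of the absolute values of the coordinates of `z ∈ ℤ^m`, written as
  the left fold `gcd(… gcd(gcd(0, |z₀|), |z₁|) …, |z_{m-1}|)` that the machine computes;
  `SIS.vecGcd_dvd`, `SIS.dvd_vecGcd`, `SIS.vecGcd_eq_zero_iff`.
* `SIS.oddPart z = z / 2^i`, `i = ν₂(vecGcd z)` the largest power of two dividing every
  coordinate (MR07, proof of Lemma 5.5: "Compute the largest power `i` such that `2^i` divides
  all the coordinates of `z`, and output `z/2^i`"); `oddPart 0 = 0`.
* PROVED: `SIS.two_pow_mul_oddPart` (`2^i · oddPart z = z`), `SIS.exists_odd_oddPart` (a nonzero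
  `z` has an odd coordinate after division), `SIS.norm_oddPart_le` (`‖z/2^i‖ ≤ ‖z‖`),
  `SIS.mulVec_modVec_oddPart` (`A (z/2^i) = 0 (mod q)` for odd `q`), and **Lemma 5.5**
  `SIS.IsSolution.oddPart`: for odd `q`, if `z` solves the SIS instance `(q, A, β)` then
  `oddPart z` solves it as an SIS′ instance.
* Generic randomized-algorithm plumbing (dot-notation extensions of
  `Literature.Computability.Complexity.RandAlg`, `Complexity/Randomized.lean`, declared with their
  absolute names): `RandAlg.postMap A g` (run `A`, then apply the deterministic map `g` to its
  output; same coins), `RandAlg.pr_postMap` (its event probabilities are those of `A` on the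
  preimage event) and `RandAlg.isPolyTime_postMap` (PPT is preserved when `g ∈ FP`, by the
  discharged composition theorem `PolyTimeComputable.comp_holds`).

## References

* D. Micciancio, O. Regev, *Worst-case to average-case reductions based on Gaussian measures*,
  SIAM J. Comput. 37(1) (2007) 267–302; authors' full version: Def. 5.1, Def. 5.4 (p. 17),
  Lemma 5.5 with proof (p. 18), remark before Thm. 5.23 (p. 28: "or SIS when the modulus `q` is
  odd") [MicciancioRegev2007].
* S. Arora, B. Barak, *Computational Complexity: A Modern Approach*, CUP 2009, Def. 7.1
  (probabilistic machines as deterministic machines with a random tape), Claim 1.6 / Thm. 2.8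
  (composition of polynomial-time computations) [AroraBarak2009].
-/

noncomputable section

open Computability Literature.Computability.Complexity Literature.Algebra.EuclideanLattices

namespace Literature.Computability.Cryptography

namespace SIS

variable {n m q : ℕ}

/-! ### The gcd of the coordinates and the odd part of an integer vector -/

/-- `SIS.vecGcd z`: the gcd of the absolute values of the coordinates of `z ∈ ℤ^m`, as the left
fold from `0` over the coordinates in index order (the form computed by the machine of
`SISOddPartMachine.lean`); `vecGcd 0 = 0`. [Micciancio–Regev 2007, proof of Lemma 5.5 ("the
largest power `i` such that `2^i` divides all the coordinates")] [cite: MicciancioRegev2007, Lemma 5.5 (proof, full version p. 18)] -/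
def vecGcd (z : Fin m → ℤ) : ℕ :=
  (List.ofFn fun i => (z i).natAbs).foldl Nat.gcd 0

/-- The exponent `i = ν₂(vecGcd z)` of the largest power of two dividing all coordinates of `z`
(`0` for `z = 0`). [Micciancio–Regev 2007, proof of Lemma 5.5] [cite: MicciancioRegev2007, Lemma 5.5 (proof, full version p. 18)] -/
def oddPartExp (z : Fin m → ℤ) : ℕ :=
  padicValNat 2 (vecGcd z)

/-- `SIS.oddPart z = z / 2^i` with `i = oddPartExp z` the largest power of two dividing every
coordinate: the output of the transformation of MR07 Lemma 5.5 (coordinatewise integer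
division; exact, `two_pow_mul_oddPart`). [Micciancio–Regev 2007, proof of Lemma 5.5 ("output
`z/2^i`")] [cite: MicciancioRegev2007, Lemma 5.5 (proof, full version p. 18)] -/
def oddPart (z : Fin m → ℤ) : Fin m → ℤ :=
  fun i => z i / (2 : ℤ) ^ oddPartExp z

/-- A left gcd-fold divides its seed and every element of the list. [folklore] -/
theorem foldl_gcd_dvd (l : List ℕ) :
    ∀ a : ℕ, l.foldl Nat.gcd a ∣ a ∧ ∀ x ∈ l, l.foldl Nat.gcd a ∣ x := by
  induction l with
  | nil => intro a; simp
  | cons b l ih =>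
    intro a
    obtain ⟨h1, h2⟩ := ih (Nat.gcd a b)
    refine ⟨h1.trans (Nat.gcd_dvd_left a b), fun x hx => ?_⟩
    simp only [List.mem_cons] at hx
    rcases hx with rfl | hx
    · exact h1.trans (Nat.gcd_dvd_right a x)
    · exact h2 x hx

/-- A common divisor of the seed and of all elements divides the left gcd-fold. [folklore] -/
theorem dvd_foldl_gcd {d : ℕ} (l : List ℕ) :
    ∀ a : ℕ, d ∣ a → (∀ x ∈ l, d ∣ x) → d ∣ l.foldl Nat.gcd a := by
  induction l with
  | nil => intro a ha _; simpa using ha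
  | cons b l ih =>
    intro a ha hl
    simp only [List.foldl_cons]
    exact ih _ (Nat.dvd_gcd ha (hl b (by simp))) fun x hx => hl x (by simp [hx])

/-- `vecGcd z` divides every coordinate. [folklore] -/
theorem vecGcd_dvd (z : Fin m → ℤ) (i : Fin m) : (vecGcd z : ℤ) ∣ z i := by
  rw [← Int.dvd_natAbs, Int.natCast_dvd_natCast]
  exact (foldl_gcd_dvd _ 0).2 _ (by simp [List.mem_ofFn])

/-- A common divisor of all coordinates divides `vecGcd z`. [folklore] -/
theorem dvd_vecGcd {d : ℕ} {z : Fin m → ℤ} (h : ∀ i, d ∣ (z i).natAbs) : d ∣ vecGcd z :=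
  dvd_foldl_gcd _ 0 (dvd_zero d) fun x hx => by
    simp only [List.mem_ofFn] at hx
    obtain ⟨i, rfl⟩ := hx
    exact h i

/-- `vecGcd z = 0` iff `z = 0`. [folklore] -/
theorem vecGcd_eq_zero_iff (z : Fin m → ℤ) : vecGcd z = 0 ↔ z = 0 := by
  constructor
  · intro h
    funext i
    have := vecGcd_dvd z i
    rw [h, Nat.cast_zero, zero_dvd_iff] at this
    exact this
  · rintro rfl
    refine Nat.eq_zero_of_zero_dvd (dvd_vecGcd fun i => ?_)
    simp

/-- The odd part of the zero vector is zero. [folklore] -/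
@[simp] theorem oddPart_zero : oddPart (0 : Fin m → ℤ) = 0 := by
  funext i; simp [oddPart]

/-- `2^i` divides every coordinate (`i = oddPartExp z`). [folklore] -/
theorem two_pow_oddPartExp_dvd (z : Fin m → ℤ) (i : Fin m) : (2 : ℤ) ^ oddPartExp z ∣ z i := by
  have h : ((2 ^ oddPartExp z : ℕ) : ℤ) ∣ (vecGcd z : ℤ) :=
    Int.natCast_dvd_natCast.2 pow_padicValNat_dvd
  exact_mod_cast h.trans (vecGcd_dvd z i)

/-- The division is exact: `2^i · oddPart z = z`. [Micciancio–Regev 2007, proof of Lemma 5.5] [cite: MicciancioRegev2007, Lemma 5.5 (proof, full version p. 18)] -/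
theorem two_pow_mul_oddPart (z : Fin m → ℤ) (i : Fin m) :
    (2 : ℤ) ^ oddPartExp z * oddPart z i = z i :=
  Int.mul_ediv_cancel' (two_pow_oddPartExp_dvd z i)

/-- **A nonzero vector has an odd coordinate after division by `2^i`** ("`z/2^i` has at least
one odd coordinate"): otherwise `2^{i+1}` would divide every coordinate, hence `vecGcd z ≠ 0`,
contradicting the maximality of `i = ν₂(vecGcd z)`. [Micciancio–Regev 2007, proof of Lemma 5.5] [cite: MicciancioRegev2007, Lemma 5.5 (proof, full version p. 18)] -/
theorem exists_odd_oddPart {z : Fin m → ℤ} (hz : z ≠ 0) : ∃ j, Odd (oddPart z j) := by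
  by_contra hall
  push Not at hall
  have h0 : vecGcd z ≠ 0 := fun h => hz ((vecGcd_eq_zero_iff z).1 h)
  haveI : Fact (Nat.Prime 2) := ⟨Nat.prime_two⟩
  refine pow_succ_padicValNat_not_dvd (p := 2) h0 (dvd_vecGcd fun i => ?_)
  obtain ⟨t, ht⟩ := Int.not_odd_iff_even.1 (hall i)
  have h := two_pow_mul_oddPart z i
  rw [ht] at h
  have h2 : z i = 2 ^ (oddPartExp z + 1) * t := by rw [← h]; ring
  rw [← Int.natCast_dvd_natCast, Int.dvd_natAbs, h2]
  exact ⟨t, by unfold oddPartExp; push_cast; ring⟩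

/-- Coordinates do not grow: `|oddPart z i| ≤ |z i|`. [folklore] -/
theorem natAbs_oddPart_le (z : Fin m → ℤ) (i : Fin m) : (oddPart z i).natAbs ≤ (z i).natAbs := by
  have h := congrArg Int.natAbs (two_pow_mul_oddPart z i)
  rw [Int.natAbs_mul, Int.natAbs_pow] at h
  have h2 : (1 : ℕ) ≤ (2 : ℤ).natAbs ^ oddPartExp z := Nat.one_le_two_pow
  calc (oddPart z i).natAbs = 1 * (oddPart z i).natAbs := (one_mul _).symm
    _ ≤ (2 : ℤ).natAbs ^ oddPartExp z * (oddPart z i).natAbs := Nat.mul_le_mul_right _ h2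
    _ = (z i).natAbs := h

/-- **The norm does not grow**: `‖oddPart z‖ ≤ ‖z‖` (Euclidean norms in `ℝ^m`). [Micciancio–Regev
2007, proof of Lemma 5.5 (`z/2^i` is a solution of the same instance, so of norm `≤ β`)] [cite: MicciancioRegev2007, Lemma 5.5 (proof, full version p. 18)] -/
theorem norm_oddPart_le (z : Fin m → ℤ) :
    ‖intVecToEuclidean m (oddPart z)‖ ≤ ‖intVecToEuclidean m z‖ := by
  rw [norm_intVecToEuclidean, norm_intVecToEuclidean]
  refine Real.sqrt_le_sqrt (Finset.sum_le_sum fun i _ => ?_)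
  have h := natAbs_oddPart_le z i
  have h' : |((oddPart z i : ℤ) : ℝ)| ≤ |((z i : ℤ) : ℝ)| := by
    rw [← Int.cast_abs, ← Int.cast_abs, Int.cast_le, Int.abs_eq_natAbs, Int.abs_eq_natAbs]
    exact_mod_cast h
  exact sq_le_sq.2 h'

/-- **Congruences survive for odd moduli**: if `A z = 0 (mod q)` with `q` odd then
`A (z/2^i) = 0 (mod q)` ("since the modulus `q` is odd, `z/2^i` satisfies `A(z/2^i) = 0 mod q`":
`2` is a unit modulo `q`). [Micciancio–Regev 2007, proof of Lemma 5.5] [cite: MicciancioRegev2007, Lemma 5.5 (proof, full version p. 18)] -/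
theorem mulVec_modVec_oddPart {A : Matrix (Fin n) (Fin m) (ZMod q)} {z : Fin m → ℤ} (hq : Odd q)
    (h : A.mulVec (modVec q z) = 0) : A.mulVec (modVec q (oddPart z)) = 0 := by
  have hz : modVec q z = ((2 : ZMod q) ^ oddPartExp z) • modVec q (oddPart z) := by
    funext j
    simp only [modVec, Pi.smul_apply, smul_eq_mul]
    rw [← two_pow_mul_oddPart z j]
    push_cast
    ring
  rw [hz, Matrix.mulVec_smul] at h
  have hu : IsUnit ((2 : ZMod q) ^ oddPartExp z) := by
    refine IsUnit.pow _ ?_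
    have := (ZMod.isUnit_iff_coprime 2 q).2 hq.coprime_two_left
    exact_mod_cast this
  exact (hu.smul_eq_zero).1 h

/-- **Micciancio–Regev 2007, Lemma 5.5.** For an odd modulus `q`, if `z` is a solution of the
SIS instance `(q, A, β)` then `oddPart z = z/2^i` (with `2^i` the largest power of two dividing
all coordinates of `z`) is a solution of the same instance as an SIS′ instance: it has an odd
coordinate, still satisfies `A (z/2^i) = 0 (mod q)`, and `‖z/2^i‖ ≤ ‖z‖ ≤ β`. (The "moreover"
clause — the transformation runs in polynomial time — is `SIS.oddPartFn_mem_FP` of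
`SISOddPartMachine.lean`.) [cite: MicciancioRegev2007, Lemma 5.5 (full version p. 18)] -/
theorem IsSolution.oddPart {A : Matrix (Fin n) (Fin m) (ZMod q)} {β : ℝ} {z : Fin m → ℤ}
    (h : IsSolution A β z) (hq : Odd q) : IsSolution' A β (SIS.oddPart z) :=
  ⟨exists_odd_oddPart h.1, mulVec_modVec_oddPart hq h.2.1, (norm_oddPart_le z).trans h.2.2⟩

end SIS

/-! ### Post-processing the output of a randomized algorithm -/

section PostMap

variable {α β γ : Type}

/-- `A.postMap g`: run the randomized algorithm `A` and apply the deterministic map `g` to its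
output — `run x r := g (A.run x r)`, same coin budget. Dot-notation extension of
`Literature.Computability.Complexity.RandAlg` (`Complexity/Randomized.lean`), declared with its
absolute name. [Arora–Barak 2009, Def. 7.1 (a PTM as a deterministic machine with a random tape;
composing with a deterministic post-processing)] [cite: AroraBarak2009, Def. 7.1] -/
def _root_.Literature.Computability.Complexity.RandAlg.postMap (A : RandAlg α β) (g : β → γ) :
    RandAlg α γ where
  run x r := g (A.run x r)
  coinLen := A.coinLen

/-- The run map of `A.postMap g` (definitional). [folklore] -/
@[simp] theorem _root_.Literature.Computability.Complexity.RandAlg.postMap_run (A : RandAlg α β)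
    (g : β → γ) (x : α) (r : List Bool) : (A.postMap g).run x r = g (A.run x r) :=
  rfl

/-- The coin budget of `A.postMap g` is that of `A` (definitional). [folklore] -/
@[simp] theorem _root_.Literature.Computability.Complexity.RandAlg.postMap_coinLen
    (A : RandAlg α β) (g : β → γ) : (A.postMap g).coinLen = A.coinLen :=
  rfl

/-- **Event probabilities of the post-processed algorithm** are those of `A` on the preimage
event: `Pr[(A.postMap g)(x) ∈ E] = Pr[A(x) ∈ g⁻¹(E)]`. [Mathlib `PMF.toOuterMeasure_map_apply`,
`PMF.map_comp`] [folklore] -/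
theorem _root_.Literature.Computability.Complexity.RandAlg.pr_postMap (A : RandAlg α β)
    (g : β → γ) (ea : α → List Bool) (x : α) (E : Set γ) :
    (A.postMap g).pr ea x E = A.pr ea x (g ⁻¹' E) := by
  unfold RandAlg.pr RandAlg.outputPMF
  rw [PMF.toOuterMeasure_map_apply, PMF.toOuterMeasure_map_apply]
  rfl

/-- **PPT is preserved by polynomial-time post-processing**: if `A` (string-valued) is
polynomial-time w.r.t. the input encoder `ea` and `g ∈ FP`, then so is `A.postMap g` — the run
map is `g ∘ uncurry A.run` (`PolyTimeComputable.comp_holds`, the discharged Mathlib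
`proof_wanted TM2ComputableInPolyTime.comp`), the coin budget is unchanged.
[Arora–Barak 2009, Claim 1.6 / Thm. 2.8 (composition) with Def. 7.1] [cite: AroraBarak2009, Thm. 2.8 (proof)] -/
theorem _root_.Literature.Computability.Complexity.RandAlg.isPolyTime_postMap
    {A : RandAlg α (List Bool)} {ea : α → List Bool} (hA : A.IsPolyTime ea id)
    {g : List Bool → List Bool} (hg : g ∈ FP) : (A.postMap g).IsPolyTime ea id := by
  refine ⟨?_, hA.2⟩
  have h : Function.uncurry (A.postMap g).run = g ∘ Function.uncurry A.run := by
    funext p; rfl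
  rw [h]
  exact PolyTimeComputable.comp_holds hg hA.1

end PostMap

end Literature.Computability.Cryptography

end
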